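import Summits.AtomisticToContinuum.Crystallization.Theses.HcpThetaUniversality
import Summits.AtomisticToContinuum.Crystallization.Theorems.HcpThetaUniversalityLjVirialInvSix

/-!
# Line `birth` — elaborating skeleton for crux `HcpThetaUniversality.LjGroundStatesNearInvSixMax`
# (item stmt-AtomisticToContinuum-5058, rank 4 "LJ TRANSFER"; also wanted by route VdwKissingSutherland)

Crux (concluded BY NAME by `LjGroundStatesNearInvSixMax_of` below):
for every sequence of Lennard-Jones ground states `x N` in `ℝ³`, eventually in `N` there are
`S ⊆ Fin N` with `#(Fin N ∖ S) ≤ N/1000` and a dilation `c ∈ [1, 53/50]` making `x N|S` a unit packing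
whose `r⁻⁶` double sum is `≥ #S · (L₆ − 1/20)`, `L₆ = Σ_{y ∈ hcp} ‖y‖⁻⁶` (nearest-neighbour distance 1).

Notation (spelled out in full in every statement, so that each registered stub signature is
self-contained over tree declarations): `L₆ = ∑' y : hcpStacking 1 √(2/3), ‖y‖⁻¹ ^ 6` (= 14.4549),
`L₁₂ = ∑' y : hcpStacking 1 √(2/3), ‖y‖⁻¹ ^ 12` (= 12.1323), `a⋆ = (L₁₂/L₆)^{1/6}` (= 0.97123, the
equilibrium nearest-neighbour distance of the hcp Lennard-Jones crystal, `e(hcp, a) = ½[L₁₂ a⁻¹²/12 − L₆ a⁻⁶/6]`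
is minimised at `a⋆` with value `e⋆ = −L₆²/(24 L₁₂)`).

## The line (the route's "expected proof" of the crux, cut into three registered stubs)

* `stub_energyUpperBound` (M): `limsup E(N)/N ≤ e⋆ = −L₆²/(24 L₁₂)` — the hcp crystal at its own
  equilibrium spacing is a trial state (in ε-form: `∀ ε > 0, ∀ᶠ N, E(N) ≤ (ε − L₆²/(24 L₁₂))·N`). Provable from
  the tree: `CrysEnergyLimit_holds` (`E(N)/N → ⨅_Q e(Q)`, stmt-0626) + `⨅_Q e(Q) ≤ e(hcpPeriodicConfiguration a⋆ …)`
  + the evaluation of the hcp energy per particle as the two lattice sums (cf. the landed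
  `ChessboardParticlePlanesLjBilayerHcpStubHcpPowerSums`); or directly by hcp trial blocks with an `O(N^{2/3})`
  surface term (Blanc–Lewin 2015 §1.3).
* `stub_noCompression` (XL — THE HARD STUB, the crux's heart): NO COMPRESSION IN THE BULK — eventually in `N`,
  after discarding at most `N/1000` particles, every remaining bond is `≥ (1 − 1/2000)·a⋆`, and the discarded
  particles carry `r⁻⁶` mass `≤ N/2000` (the in-tree one-centre bound `sum_inv_pow_six_le` + the minimal distance
  `LennardJonesMinimalDistance_holds` turn any `o(N)` count of compressed particles into this). Why it might fail:
  persistent icosahedral / decahedral cores (radial bonds ≈ 3% short) or strained grain boundaries at density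
  `> 10⁻³`; the tolerance `5·10⁻⁴` is forced by the crux's `1/20` budget (`6 η L₆ ≲ 1/20`).
* `stub_hcpLatticeSumWindow` (S/M, certified numerics of the two hcp lattice sums): `12 ≤ L₁₂ ≤ L₆ ≤ 16`
  (first shell; termwise comparison at minimal distance 1; a tail bound — true values 12.13 / 14.45; the tree has
  `summable_hcp_inv_norm_pow_six` and `hcp_six_shells_le_tsum : 13.859 ≤ L₆`).

## Glue (`ljGroundStatesNearInvSixMax_of_stubs`, sorry-free, ≈ 90 lines)

VIRIAL IDENTITY (in tree, `ljVirialInvSix_proof`, item 5061): `𝓔(x N) = −(1/24) Σ_{i,j} r_ij⁻⁶`, so with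
`E(N) = 𝓔(x N) ≤ (1/48000 − L₆²/(24L₁₂)) N` (stub 1 at `ε = 1/48000`): `T := Σ_{i,j} r⁻⁶ ≥ N (L₆²/L₁₂ − 1/2000)`.
Restrict to `S` (stub 2): `Σ_{S×S} r⁻⁶ ≥ T − 2 Σ_{i ∉ S} Σ_j r_ij⁻⁶ ≥ N (L₆²/L₁₂ − 3/2000)` (symmetry of `dist`).
Dilate by `c = 1/((1 − 1/2000) a⋆)`: `c ∈ [1, 53/50]` iff `(50/53)⁶ ≤ (1 − 1/2000)⁶ L₁₂/L₆ ≤ 1`, which is stub 3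
(`L₁₂/L₆ ∈ [12/16, 1]`); `c · r ≥ 1` on `S` is stub 2; and
`Σ_{S×S} (c r)⁻⁶ = (1 − 1/2000)⁶ (L₁₂/L₆) Σ_{S×S} r⁻⁶ ≥ (1 − 1/2000)⁶ N (L₆ − 3/2000) ≥ N (L₆ − 1/20) ≥ #S (L₆ − 1/20)`,
the middle inequality being the BUDGET `(1 − (1 − 1/2000)⁶)·L₆ + (3/2000)(1 − 1/2000)⁶ ≤ 1/20`, true for
`L₆ ≤ 16` (stub 3) with margin `5·10⁻⁴`.

Disproof used: none exists for this crux yet (`ledger crux ls stmt-AtomisticToContinuum-5058`: no Disproof.lean,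
no Negative lemmas, 2026-08-17). Dead lines: none recorded. The skeleton's only inputs besides the stubs are the
landed virial identity and Mathlib.
-/

noncomputable section

open scoped BigOperators
open Filter Literature.MathematicalPhysics.StatisticalMechanics

namespace Summit.AtomisticToContinuum.Crystallization.Cruxes.LjGroundStatesNearInvSixMax.Birth

/-! ## Registered stubs (the only sorries of the file) -/

/-- **Stub 1 (M) — trial upper bound on the ground-state energy by the equilibrium hcp crystal**:
`limsup_N E(N)/N ≤ e⋆ = −L₆²/(24 L₁₂)`, in ε-form. [BlancLewin2015 §1.3, §2.1 (23)] -/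
theorem stub_energyUpperBound :
    ∀ ε : ℝ, 0 < ε → ∀ᶠ N : ℕ in Filter.atTop,
      Literature.MathematicalPhysics.StatisticalMechanics.groundStateEnergy
          Literature.MathematicalPhysics.StatisticalMechanics.lennardJones 3 N ≤
        (ε - (∑' y : ↥(Literature.MathematicalPhysics.StatisticalMechanics.hcpStacking 1 (Real.sqrt (2 / 3))),
              ‖(y : EuclideanSpace ℝ (Fin 3))‖⁻¹ ^ 6) ^ 2 /
            (24 * ∑' y : ↥(Literature.MathematicalPhysics.StatisticalMechanics.hcpStacking 1 (Real.sqrt (2 / 3))),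
              ‖(y : EuclideanSpace ℝ (Fin 3))‖⁻¹ ^ 12)) * (N : ℝ) := by
  sorry

/-- **Stub 2 (XL, the hard one) — no compression in the bulk of large Lennard-Jones ground states**:
eventually in `N`, all but `≤ N/1000` particles have every bond `≥ (1 − 1/2000)·a⋆`,
`a⋆ = (L₁₂/L₆)^{1/6}`, and the discarded particles carry `r⁻⁶` mass `≤ N/2000`.
[BlancLewin2015 §2.2; Xue1997; Blanc2004 (minimal distance only — the quantitative statement is new)] -/
theorem stub_noCompression :
    ∀ x : (N : ℕ) → (Fin N → EuclideanSpace ℝ (Fin 3)),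
      (∀ N, Literature.MathematicalPhysics.StatisticalMechanics.IsGroundState
        Literature.MathematicalPhysics.StatisticalMechanics.lennardJones (x N)) →
      ∀ᶠ N in Filter.atTop, ∃ S : Finset (Fin N),
        1000 * ((N : ℝ) - S.card) ≤ N ∧
        (∀ i ∈ S, ∀ j ∈ S, i ≠ j →
          (1 - 1 / 2000) *
              ((∑' y : ↥(Literature.MathematicalPhysics.StatisticalMechanics.hcpStacking 1 (Real.sqrt (2 / 3))),
                  ‖(y : EuclideanSpace ℝ (Fin 3))‖⁻¹ ^ 12) /
                (∑' y : ↥(Literature.MathematicalPhysics.StatisticalMechanics.hcpStacking 1 (Real.sqrt (2 / 3))),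
                  ‖(y : EuclideanSpace ℝ (Fin 3))‖⁻¹ ^ 6)) ^ ((1 : ℝ) / 6) ≤
            dist (x N i) (x N j)) ∧
        ∑ i ∈ Finset.univ \ S, ∑ j, (dist (x N i) (x N j))⁻¹ ^ 6 ≤ (N : ℝ) / 2000 := by
  sorry

/-- **Stub 3 (S/M, certified numerics) — the hcp lattice-sum window**: `12 ≤ L₁₂ ≤ L₆ ≤ 16`
(twelve nearest neighbours at distance 1; termwise `‖y‖⁻¹² ≤ ‖y‖⁻⁶` at minimal distance 1; a tail bound;
true values `L₁₂ = 12.132`, `L₆ = 14.455`). [ConwaySloane1999; in tree: `hcp_six_shells_le_tsum`] -/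
theorem stub_hcpLatticeSumWindow :
    (12 : ℝ) ≤ (∑' y : ↥(Literature.MathematicalPhysics.StatisticalMechanics.hcpStacking 1 (Real.sqrt (2 / 3))),
        ‖(y : EuclideanSpace ℝ (Fin 3))‖⁻¹ ^ 12) ∧
    (∑' y : ↥(Literature.MathematicalPhysics.StatisticalMechanics.hcpStacking 1 (Real.sqrt (2 / 3))),
        ‖(y : EuclideanSpace ℝ (Fin 3))‖⁻¹ ^ 12) ≤
      (∑' y : ↥(Literature.MathematicalPhysics.StatisticalMechanics.hcpStacking 1 (Real.sqrt (2 / 3))),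
        ‖(y : EuclideanSpace ℝ (Fin 3))‖⁻¹ ^ 6) ∧
    (∑' y : ↥(Literature.MathematicalPhysics.StatisticalMechanics.hcpStacking 1 (Real.sqrt (2 / 3))),
        ‖(y : EuclideanSpace ℝ (Fin 3))‖⁻¹ ^ 6) ≤ 16 := by
  sorry

/-! ## The glue (sorry-free) -/

set_option maxHeartbeats 400000 in
/-- **Composition of the line** (sorry-free): stub 1 → stub 2 → stub 3 → the crux statement (unfolded), via the
landed virial identity `ljVirialInvSix_proof`. -/
theorem ljGroundStatesNearInvSixMax_of_stubs
    (hE : ∀ ε : ℝ, 0 < ε → ∀ᶠ N : ℕ in Filter.atTop,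
      groundStateEnergy lennardJones 3 N ≤
        (ε - (∑' y : ↥(hcpStacking 1 (Real.sqrt (2 / 3))), ‖(y : EuclideanSpace ℝ (Fin 3))‖⁻¹ ^ 6) ^ 2 /
            (24 * ∑' y : ↥(hcpStacking 1 (Real.sqrt (2 / 3))), ‖(y : EuclideanSpace ℝ (Fin 3))‖⁻¹ ^ 12)) * (N : ℝ))
    (hNC : ∀ x : (N : ℕ) → (Fin N → EuclideanSpace ℝ (Fin 3)),
      (∀ N, IsGroundState lennardJones (x N)) →
      ∀ᶠ N in Filter.atTop, ∃ S : Finset (Fin N),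
        1000 * ((N : ℝ) - S.card) ≤ N ∧
        (∀ i ∈ S, ∀ j ∈ S, i ≠ j →
          (1 - 1 / 2000) *
              ((∑' y : ↥(hcpStacking 1 (Real.sqrt (2 / 3))), ‖(y : EuclideanSpace ℝ (Fin 3))‖⁻¹ ^ 12) /
                (∑' y : ↥(hcpStacking 1 (Real.sqrt (2 / 3))), ‖(y : EuclideanSpace ℝ (Fin 3))‖⁻¹ ^ 6)) ^
              ((1 : ℝ) / 6) ≤ dist (x N i) (x N j)) ∧
        ∑ i ∈ Finset.univ \ S, ∑ j, (dist (x N i) (x N j))⁻¹ ^ 6 ≤ (N : ℝ) / 2000)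
    (hW : (12 : ℝ) ≤ (∑' y : ↥(hcpStacking 1 (Real.sqrt (2 / 3))), ‖(y : EuclideanSpace ℝ (Fin 3))‖⁻¹ ^ 12) ∧
      (∑' y : ↥(hcpStacking 1 (Real.sqrt (2 / 3))), ‖(y : EuclideanSpace ℝ (Fin 3))‖⁻¹ ^ 12) ≤
        (∑' y : ↥(hcpStacking 1 (Real.sqrt (2 / 3))), ‖(y : EuclideanSpace ℝ (Fin 3))‖⁻¹ ^ 6) ∧
      (∑' y : ↥(hcpStacking 1 (Real.sqrt (2 / 3))), ‖(y : EuclideanSpace ℝ (Fin 3))‖⁻¹ ^ 6) ≤ 16) :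
    ∀ x : (N : ℕ) → (Fin N → EuclideanSpace ℝ (Fin 3)),
      (∀ N, IsGroundState lennardJones (x N)) →
      ∀ᶠ N in Filter.atTop, ∃ (S : Finset (Fin N)) (c : ℝ),
        1000 * ((N : ℝ) - S.card) ≤ N ∧ 1 ≤ c ∧ c ≤ 53 / 50 ∧
        (∀ i ∈ S, ∀ j ∈ S, i ≠ j → 1 ≤ c * dist (x N i) (x N j)) ∧
        (S.card : ℝ) * ((∑' y : ↥(hcpStacking 1 (Real.sqrt (2 / 3))), ‖(y : EuclideanSpace ℝ (Fin 3))‖⁻¹ ^ 6) -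
            1 / 20) ≤ ∑ i ∈ S, ∑ j ∈ S, (c * dist (x N i) (x N j))⁻¹ ^ 6 := by
  -- the two hcp lattice sums
  set L : ℝ := ∑' y : ↥(hcpStacking 1 (Real.sqrt (2 / 3))), ‖(y : EuclideanSpace ℝ (Fin 3))‖⁻¹ ^ 6 with hL
  set M : ℝ := ∑' y : ↥(hcpStacking 1 (Real.sqrt (2 / 3))), ‖(y : EuclideanSpace ℝ (Fin 3))‖⁻¹ ^ 12 with hM
  obtain ⟨h12, hML, hL16⟩ := hW
  have hMpos : 0 < M := lt_of_lt_of_le (by norm_num) h12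
  have hLpos : 0 < L := lt_of_lt_of_le hMpos hML
  have hM0 : M ≠ 0 := hMpos.ne'
  have hL0 : L ≠ 0 := hLpos.ne'
  -- the budget constant q = (1 - 1/2000)⁶ ∈ [0.997, 1]
  set q : ℝ := (1 - 1 / 2000) ^ 6 with hq
  have hq_lo : (997 : ℝ) / 1000 ≤ q := by rw [hq]; norm_num
  have hq_hi : q ≤ 1 := by rw [hq]; norm_num
  -- the ratio ρ = L₁₂ / L₆ ∈ [3/4, 1]
  set ρ : ℝ := M / L with hρ
  have hρpos : 0 < ρ := div_pos hMpos hLpos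
  have hρle : ρ ≤ 1 := (div_le_one hLpos).2 hML
  have hρge : 3 / 4 ≤ ρ := by
    rw [hρ, le_div_iff₀ hLpos]
    linarith
  -- the no-compression scale a = (1 - 1/2000) ρ^{1/6} ∈ [50/53, 1] and the dilation c = a⁻¹ ∈ [1, 53/50]
  set r : ℝ := ρ ^ ((1 : ℝ) / 6) with hr
  have hrpos : 0 < r := Real.rpow_pos_of_pos hρpos _
  have hrle : r ≤ 1 := Real.rpow_le_one hρpos.le hρle (by norm_num)
  have hr6 : r ^ 6 = ρ := by
    rw [hr, ← Real.rpow_natCast, ← Real.rpow_mul hρpos.le]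
    norm_num
  set a : ℝ := (1 - 1 / 2000) * r with ha
  have hapos : 0 < a := by rw [ha]; positivity
  have hale : a ≤ 1 := by rw [ha]; nlinarith
  have ha6 : a ^ 6 = q * ρ := by rw [ha, mul_pow, hr6]
  have hage : 50 / 53 ≤ a := by
    have h6 : (50 / 53 : ℝ) ^ 6 ≤ a ^ 6 := by
      rw [ha6]
      calc (50 / 53 : ℝ) ^ 6 ≤ (997 / 1000) * (3 / 4) := by norm_num
        _ ≤ q * ρ := mul_le_mul hq_lo hρge (by norm_num) (le_trans (by norm_num) hq_lo)
    exact (pow_le_pow_iff_left₀ (by norm_num) hapos.le (by norm_num)).1 h6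
  set c : ℝ := a⁻¹ with hc
  have hcpos : 0 < c := inv_pos.2 hapos
  have hc1 : 1 ≤ c := (one_le_inv₀ hapos).2 hale
  have hc2 : c ≤ 53 / 50 := by
    calc c = a⁻¹ := hc
      _ ≤ (50 / 53 : ℝ)⁻¹ := inv_anti₀ (by norm_num) hage
      _ = 53 / 50 := by norm_num
  -- the budget: (1 - q) L + 3q/2000 ≤ 1/20 for L ≤ 16
  have hqL : (1 - q) * L ≤ (1 - q) * 16 := mul_le_mul_of_nonneg_left hL16 (by linarith)
  have hbudget : 0 ≤ 1 / 20 - 3 * q / 2000 - (1 - q) * L := by nlinarith [hqL, hq_lo, hq_hi]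
  intro x hx
  -- eventuality 1: the virial identity and the trial upper bound give T = Σ_{i,j} r⁻⁶ ≥ N (L²/M − 1/2000)
  have ev1 : ∀ᶠ N : ℕ in atTop,
      (N : ℝ) * (L ^ 2 / M - 1 / 2000) ≤ ∑ i, ∑ j, (dist (x N i) (x N j))⁻¹ ^ 6 := by
    filter_upwards [hE (1 / 48000) (by norm_num)] with N hN
    have hv := Summit.AtomisticToContinuum.Crystallization.Theorems.ljVirialInvSix_proof N (x N) (hx N)
    have hg : interactionEnergy lennardJones (x N) = groundStateEnergy lennardJones 3 N := (hx N).2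
    have hT : ∑ i, ∑ j, (dist (x N i) (x N j))⁻¹ ^ 6 = -24 * groundStateEnergy lennardJones 3 N := by
      rw [← hg, hv]
      ring
    have hid : (N : ℝ) * (L ^ 2 / M - 1 / 2000) = -24 * ((1 / 48000 - L ^ 2 / (24 * M)) * (N : ℝ)) := by
      field_simp
      ring
    rw [hT, hid]
    nlinarith [hN]
  filter_upwards [ev1, hNC x hx] with N h1 h2
  obtain ⟨S, hcard, hsep, hmass⟩ := h2
  refine ⟨S, c, hcard, hc1, hc2, fun i hi j hj hij => ?_, ?_⟩
  · -- unit packing after dilation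
    have hd := hsep i hi j hj hij
    calc (1 : ℝ) = c * a := by rw [hc, inv_mul_cancel₀ hapos.ne']
      _ ≤ c * dist (x N i) (x N j) := mul_le_mul_of_nonneg_left hd hcpos.le
  · -- the r⁻⁶ bookkeeping
    have hN0 : (0 : ℝ) ≤ N := Nat.cast_nonneg N
    have hSN : (S.card : ℝ) ≤ N := by
      have h := S.card_le_univ
      rw [Fintype.card_fin] at h
      exact_mod_cast h
    -- abbreviate the pair weights
    set f : Fin N → Fin N → ℝ := fun i j => (dist (x N i) (x N j))⁻¹ ^ 6 with hf
    have hf0 : ∀ i j, 0 ≤ f i j := fun i j => by rw [hf]; positivity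
    have hfsymm : ∀ i j, f i j = f j i := fun i j => by simp only [hf, dist_comm]
    -- (i) pull the dilation out: Σ_{S×S} (c r)⁻⁶ = a⁶ Σ_{S×S} r⁻⁶
    have key : ∑ i ∈ S, ∑ j ∈ S, (c * dist (x N i) (x N j))⁻¹ ^ 6 = a ^ 6 * ∑ i ∈ S, ∑ j ∈ S, f i j := by
      rw [Finset.mul_sum]
      refine Finset.sum_congr rfl fun i _ => ?_
      rw [Finset.mul_sum]
      refine Finset.sum_congr rfl fun j _ => ?_
      show (c * dist (x N i) (x N j))⁻¹ ^ 6 = a ^ 6 * (dist (x N i) (x N j))⁻¹ ^ 6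
      rw [mul_inv, mul_pow, hc, inv_inv]
    -- (ii) restriction to S × S costs at most twice the removed mass
    have hrow : ∀ i, ∑ j, f i j = ∑ j ∈ S, f i j + ∑ j ∈ Finset.univ \ S, f i j := fun i => by
      rw [add_comm, Finset.sum_sdiff (Finset.subset_univ S)]
    have hsplit : ∑ i, ∑ j, f i j =
        (∑ i ∈ S, ∑ j ∈ S, f i j + ∑ i ∈ S, ∑ j ∈ Finset.univ \ S, f i j) +
          ∑ i ∈ Finset.univ \ S, ∑ j, f i j := by
      calc ∑ i, ∑ j, f i j = ∑ i ∈ S, ∑ j, f i j + ∑ i ∈ Finset.univ \ S, ∑ j, f i j := by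
            rw [add_comm, Finset.sum_sdiff (Finset.subset_univ S)]
        _ = _ := by rw [Finset.sum_congr rfl fun i (_ : i ∈ S) => hrow i, Finset.sum_add_distrib]
    have hcross : ∑ i ∈ S, ∑ j ∈ Finset.univ \ S, f i j ≤ ∑ i ∈ Finset.univ \ S, ∑ j, f i j := by
      rw [Finset.sum_comm]
      refine Finset.sum_le_sum fun j _ => ?_
      calc ∑ i ∈ S, f i j ≤ ∑ i, f i j := Finset.sum_le_univ_sum_of_nonneg fun i => hf0 i j
        _ = ∑ i, f j i := Finset.sum_congr rfl fun i _ => hfsymm i j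
    have hA : ∑ i, ∑ j, f i j - 2 * ∑ i ∈ Finset.univ \ S, ∑ j, f i j ≤ ∑ i ∈ S, ∑ j ∈ S, f i j := by
      linarith [hsplit, hcross]
    have hT : (N : ℝ) * (L ^ 2 / M - 1 / 2000) ≤ ∑ i, ∑ j, f i j := h1
    have hR : ∑ i ∈ Finset.univ \ S, ∑ j, f i j ≤ (N : ℝ) / 2000 := hmass
    -- (iii) ρ · Σ_{S×S} r⁻⁶ ≥ N L − 3N/2000
    have hTR : (N : ℝ) * (L ^ 2 / M - 1 / 2000) - 2 * ((N : ℝ) / 2000) ≤ ∑ i ∈ S, ∑ j ∈ S, f i j := by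
      linarith [hA, hT, hR]
    have hidρ : ρ * ((N : ℝ) * (L ^ 2 / M - 1 / 2000) - 2 * ((N : ℝ) / 2000)) =
        (N : ℝ) * L - ρ * N * (3 / 2000) := by
      rw [hρ]
      field_simp
      ring
    have hρA : (N : ℝ) * L - (N : ℝ) * (3 / 2000) ≤ ρ * ∑ i ∈ S, ∑ j ∈ S, f i j := by
      have hmul := mul_le_mul_of_nonneg_left hTR hρpos.le
      have hρN : ρ * N * (3 / 2000) ≤ (N : ℝ) * (3 / 2000) := by nlinarith [hρle, hN0]
      linarith [hmul, hidρ, hρN]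
    -- (iv) the budget
    have hL20 : (0 : ℝ) ≤ L - 1 / 20 := by linarith [h12, hML]
    have step1 : (S.card : ℝ) * (L - 1 / 20) ≤ (N : ℝ) * (L - 1 / 20) :=
      mul_le_mul_of_nonneg_right hSN hL20
    have step2 : (N : ℝ) * (L - 1 / 20) ≤ q * ((N : ℝ) * L - (N : ℝ) * (3 / 2000)) := by
      have hid2 : q * ((N : ℝ) * L - (N : ℝ) * (3 / 2000)) - (N : ℝ) * (L - 1 / 20) =
          (N : ℝ) * (1 / 20 - 3 * q / 2000 - (1 - q) * L) := by ring
      have hnn : 0 ≤ (N : ℝ) * (1 / 20 - 3 * q / 2000 - (1 - q) * L) := mul_nonneg hN0 hbudget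
      linarith [hid2, hnn]
    have hq0 : (0 : ℝ) ≤ q := le_trans (by norm_num) hq_lo
    have step3 : q * ((N : ℝ) * L - (N : ℝ) * (3 / 2000)) ≤ q * (ρ * ∑ i ∈ S, ∑ j ∈ S, f i j) :=
      mul_le_mul_of_nonneg_left hρA hq0
    rw [key, ha6]
    calc (S.card : ℝ) * (L - 1 / 20) ≤ q * (ρ * ∑ i ∈ S, ∑ j ∈ S, f i j) :=
          step1.trans (step2.trans step3)
      _ = q * ρ * ∑ i ∈ S, ∑ j ∈ S, f i j := (mul_assoc _ _ _).symm

/-- **The line concludes the crux BY NAME**: the registered stubs 1–3 and the glue above give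
`HcpThetaUniversality.LjGroundStatesNearInvSixMax` (no sorry of its own; the sorries live in `stub_*`). -/
theorem LjGroundStatesNearInvSixMax_of :
    Summit.AtomisticToContinuum.Crystallization.Theses.HcpThetaUniversality.LjGroundStatesNearInvSixMax :=
  ljGroundStatesNearInvSixMax_of_stubs stub_energyUpperBound stub_noCompression stub_hcpLatticeSumWindow

end Summit.AtomisticToContinuum.Crystallization.Cruxes.LjGroundStatesNearInvSixMax.Birth

end
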